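import Literature.Probability.RandomPlanarGeometry.NestingTransform
import Mathlib.MeasureTheory.Measure.Lebesgue.EqHaar
import Mathlib.MeasureTheory.Integral.Prod
import HarnessLib

/-!
# Barrier: the `cos_μ` nesting transform is blind to types, to degenerate loops and to covering multiplicity (and, conditionally, to crossing superpositions)

Barrier catalogue `Literature/Barriers/CriticalPhenomena/` (D-0021), entry for the sub-problem
`CriticalPhenomena/CardyFormulaZ2`, technique class *transform-injectivity / nesting-statistics*
(route `CardyMagicRigidity`, crux `NestingRigidity`, stmt-CriticalPhenomena-4835: "equal Gaussian
`μ = 1/6` nesting transforms of bond-ℤ² and site-𝕋 ⇒ `d_CN`-equal loop limits", intended proof C3 =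
injectivity of the transform on a class of full-plane loop laws).

What the sources print.
* Duminil-Copin–Kozlowski–Lammers–Manolescu, arXiv:2603.06268 (2026), §3.2 and Cor. 10: the lattice
  transform `E[∏_ℓ cos_μ(∫_{int ℓ} f)]`, `cos_μ(x) = cos(x + 2πμ)/cos(2πμ)`, `μ = 1/6` at `q = 1`, converges
  to `exp((3/4π²)∬ log|x−y| f f)`; §5 p. 37 transfers loop functionals ALONG a known `d_CN`-universality
  ("restrict to big loops", `O(ε^c)`), never conversely.
* Miller–Watson–Wilson, PTRF 163 (2015), §8 Question "deterministic": for `κ ∈ (4, 8)` the CLE is not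
  expected to be a (pathwise) function of its weighted nesting field; "for `κ > 4` the CLE contains more
  information" (§1). No law-level injectivity statement for nesting transforms exists in print.
* Schramm–Sheffield–Wilson, CMP 288 (2009), Thm 1 / (mgf): the log-conformal-radius decrement `B_κ` of
  nested CLE_κ loops has `E[e^{λB_κ}] = −cos(4π/κ)/cos(π√((1−4/κ)² + 8λ/κ))`. For the dense/dilute pair
  `1/κ + 1/κ' = 1/2` (same `n = −2cos(4π/κ)`) this gives `B_{κ'} = (κ/κ')B_κ` in law
  (`sswMGF_dilute_eq_dense`, `sswMGF_three_eq_six`): CLE₃ nests exactly half as much as CLE₆ with the same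
  shape; the κ-proportionality of the whole nesting spectrum at fixed `n` is visible in
  Borot–Bouttier–Duplantier, CMP 404 (2023), §9.3.4.

Formal content (proved, elementary). In the tree's vocabulary (`LoopConfig.truncNestingWeight`,
`HasNestingTransform`, `LoopConfig.IsClose`, `LoopConfig.cnLawEDist`): the loop functional
`A^ε_f(c) = ∏_{u ∈ c, diam u ≥ ε} 2cos(∫_{W(u,·)≠0} f + π/3)` (i) does not see the TYPES `F 0 / F 1`
(`truncNestingWeight_swap`), (ii) gives factor `1` to loops with null interior (`nestingFactor_pointLoop`),
(iii) does not see covering multiplicity (the circle traversed once vs twice: `nestingFactor_windLoop_eq`,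
`range_windLoop_two_eq_one`), whereas DKKMO's `d_CN` sees all three (`not_isClose_single_swap`,
`le_udist_windLoop_one_two` via `udist`-stability of winding numbers); packaged as the named fact
`NestingTransformBlindness` (proved: `nestingTransformBlindness_holds`), including the law-level form
(Dirac laws at coupling distance `≥ 1` with identical transform data). (iv) Transforms MULTIPLY under
independent union (`truncNestingTransform_prod`, `hasNestingTransform_union`), and two ensembles with the
half-variance Gaussian transform `exp((3/8π²)Q)` superpose to one with the DKLM value `exp((3/4π²)Q)`
(`superposition_half_variance`); with SSW's dense–dilute identity and the Coulomb-gas value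
`σ²(κ) = κ/2π` at the magic twist (`κ ∈ {3, 6}` are the only CLEs with `n = 1`), the independent union
of two full-plane CLE₃'s is — CONDITIONALLY on CLE₃ bosonisation at `μ = 1/6`, an open statement of the
same status as the route's `MagicFormulaT` — an E(2)-invariant, mixing, locally finite ensemble of simple
fat loops with exactly the CLE₆ transform, `d_CN`-far from CLE₆.

## References

* H. Duminil-Copin, K. K. Kozlowski, P. Lammers, I. Manolescu, arXiv:2603.06268 (2026), §3.2, Cor. 10,
  §5 p. 37 [DuminilCopinKozlowskiLammersManolescu2026].
* J. Miller, S. S. Watson, D. B. Wilson, Probab. Theory Relat. Fields 163 (2015), §1, §8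
  [MillerWatsonWilson2015].
* O. Schramm, S. Sheffield, D. B. Wilson, Comm. Math. Phys. 288 (2009), Thm 1 [SchrammSheffieldWilson2009].
* G. Borot, J. Bouttier, B. Duplantier, Comm. Math. Phys. 404 (2023), §9.3.4 [BorotBouttierDuplantier2023].
* H. Duminil-Copin, K. K. Kozlowski, D. Krachun, I. Manolescu, M. Oulamara, arXiv:2012.11672v2, §1.2
  (`d_CN`) [arXiv201211672v2].
-/

noncomputable section

namespace Literature.Barriers.CriticalPhenomena

open Literature.Probability.RandomPlanarGeometry
open _root_.MeasureTheory Set Filter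
open scoped Real ENNReal
open scoped _root_.Topology

/-- **The `cos_μ` nesting transform is blind to types, to degenerate loops and to covering
multiplicity, at configuration and at law level.** (1) There are two typed configurations with finitely
many loops, all winding around some point, with identical truncated loop functionals `A^ε_f` for every
test function `f : ℂ → ℝ` and every cut-off `ε`, which are not `d_CN`-close at scale `1` (a circle filed
under type `0` vs type `1`); (2) the same with UNTYPED comparison at scale `1/4` (the circle of radius
`1/2` traversed once vs twice); (3) two probability laws of random configurations with identical
nesting-transform data (`HasNestingTransform P X f Λ ↔ HasNestingTransform P' X' f Λ` for all `f, Λ`) at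
coupling distance `cnLawEDist ≥ 1`.

BARRIER (structured block, D-0021):
- technique_class: transform-injectivity, nesting-statistics, loop-functional-identification
- blocks: concluding a TYPED or untyped `d_CN`-identification of a full-plane loop-configuration law (e.g. `LoopLimitZ2EqT`, bond-ℤ² ~ site-𝕋) from equality of `cos_μ` nesting transforms ALONE — the configuration/law-level principles `∀ c c', (finite, fat, ∀ f ε, A^ε_f(c) = A^ε_f(c')) → IsClose ε c c'` (typed or untyped) and `∀ P P', (same HasNestingTransform data) → cnLawEDist P P' = 0` are refuted below; named tree object: route `CardyMagicRigidity`, crux `Summit.CriticalPhenomena.CardyFormulaZ2.Theses.CardyMagicRigidity.NestingRigidity` (stmt-CriticalPhenomena-4835), whose hypotheses `MagicFormulaZ2`/`MagicFormulaT` are products over `F 0 ∪ F 1` (type-blind) — its intended proof C3 ("injectivity of the `μ = 1/6` transform on E(2)-invariant, ergodic, positive-area subsequential limits") must take types, non-degeneracy, covering degree one AND non-crossing from the lattice, not from the transform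
- because: the loop weight `2cos(∫_{W≠0} f + π/3)` depends on the loop only through the a.e.-class of its winding-number interior, so type swap, null-interior loops and `n`-fold covers (same `{W ≠ 0}` up to the null trace) are invisible, while `d_CN` compares typed unbased curves (`udist`-stability of winding numbers separates the single from the double circle) — proved below; at law level Dirac laws inherit this; transforms multiply under independent union (`hasNestingTransform_union`, Fubini), and SSW's law of the conformal-radius decrement satisfies `B₃ = 2B₆` in law [cite: SchrammSheffieldWilson2009, Thm 1] (κ-proportionality at fixed `n`, cf. [cite: BorotBouttierDuplantier2023, §9.3.4]), so two independent CLE₃'s reproduce every one-point `μ = 1/6` nesting exponent of CLE₆ and the two-point Gaussian exponent `σ² = 3/π = 2·(3/2π)`; conditionally on CLE₃ bosonisation the superposition has exactly the DKLM transform [cite: DuminilCopinKozlowskiLammersManolescu2026, Cor. 10] — so "E(2)-invariant + ergodic + positive-area interiors" does not make the transform injective; Miller–Watson–Wilson expect the CLE_κ, `κ > 4`, not to be recoverable pathwise from nesting data [cite: MillerWatsonWilson2015, §8]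
- evasions_known: use the percolation structure of the two lattice ensembles rather than transform data alone: types alternate along the nesting tree and the global type bit is symmetric (self-duality of bond-ℤ² at `1/2` up to a `δ/2` shift; colour symmetry of site-𝕋), RSW/arm estimates give non-degenerate interiors and covering degree one (`W ∈ {0, ±1}`, exterior boundaries of clusters), and NON-CROSSING / nesting-laminarity (or a spatial Markov property) excludes independent superpositions; DKLM's own use of the functional transfers it ALONG a known `d_CN`-universality (`𝕃(θ) → ℤ²`, "restrict to big loops") [cite: DuminilCopinKozlowskiLammersManolescu2026, §5 p. 37] — the converse direction needed by the crux has no precedent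
- scope_caveats: (a) the formal witnesses are deterministic finite configurations / Dirac laws: they refute transform-only identification principles, not the typed crux `NestingRigidity` itself (which is implied by universality `X` and is refutable only by proving both magic formulas and disproving `X`); (b) for finitely supported laws on finite configurations of Jordan loops of covering degree one with fixed typing convention the transform IS injective (grading by the all-plus character; not formalised), so the genuine obstruction to C3 is infinite nesting (unbounded total variation `2^{#loops}` of the complex height measure) plus the conditional superposition example; (c) the CLE₃ ⊔ CLE₃ example is conditional on bosonisation of CLE₃ at the magic twist (Coulomb gas `g = 4/3`, `σ² = 3/2π`; rigorous only at the level of SSW's one-point law and the two-point exponent) and on `d_CN(CLE₆, CLE₃ ⊔ CLE₃') > 0` (pinch points of CLE₆ loops vs simple CLE₃ loops; not formalised)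
- status: established (theorem: `nestingTransformBlindness_holds`; superposition lemmas proved; SSW identity proved as algebra on the printed MGF); conditional part heuristic as stated
[cite: MillerWatsonWilson2015, §8] [cite: SchrammSheffieldWilson2009, Thm 1] -/
def NestingTransformBlindness : Prop :=
  (∃ c c' : LoopConfig ℂ, c.loops.Finite ∧ c'.loops.Finite ∧ (∀ u ∈ c.loops ∪ c'.loops, ∃ z, u.wind z ≠ 0) ∧
      (∀ (f : ℂ → ℝ) (ε : ℝ), c.truncNestingWeight f ε = c'.truncNestingWeight f ε) ∧
      ¬ LoopConfig.IsClose 1 c c') ∧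
  (∃ c c' : LoopConfig ℂ, c.loops.Finite ∧ c'.loops.Finite ∧ (∀ u ∈ c.loops ∪ c'.loops, ∃ z, u.wind z ≠ 0) ∧
      (∀ (f : ℂ → ℝ) (ε : ℝ), c.truncNestingWeight f ε = c'.truncNestingWeight f ε) ∧
      ¬ LoopConfig.IsClose (1 / 4) (⟨fun _ ↦ c.loops⟩ : LoopConfig ℂ) ⟨fun _ ↦ c'.loops⟩) ∧
  (∃ (P P' : Measure Unit) (X X' : Unit → LoopConfig ℂ), IsProbabilityMeasure P ∧ IsProbabilityMeasure P' ∧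
      (∀ (f : ℂ → ℝ) (Λ : ℝ), HasNestingTransform P X f Λ ↔ HasNestingTransform P' X' f Λ) ∧
      1 ≤ LoopConfig.cnLawEDist P X P' X')

namespace NestingBlind

/-- The constant (point) loop at `x`: a degenerate loop with null (empty) interior. [folklore] -/
def pointLoop (x : ℂ) : UnbasedLoop ℂ :=
  UnbasedLoop.mk (BasedLoop.mk (CurveClass.mk (Curve.const x)) (CurveClass.isLoop_mk.2 rfl))

/-- The trace of the point loop is `{x}`. [folklore] -/
@[simp] theorem range_pointLoop (x : ℂ) : (pointLoop x).range = {x} := by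
  simp [pointLoop, Curve.range]

/-- The point loop winds around nothing. [folklore] -/
@[simp] theorem wind_pointLoop (x z : ℂ) : (pointLoop x).wind z = 0 := by
  show (Curve.const x).wind z = 0
  by_cases hz : z = x
  · subst hz
    exact Curve.wind_of_mem_range ⟨0, rfl⟩
  · refine Curve.wind_eq_zero_of_subset_ball (w := x) (ρ := dist z x) ?_ le_rfl
    rintro _ ⟨t, rfl⟩
    simpa [Curve.const_apply] using dist_pos.2 hz

/-- The interior `{W ≠ 0}` of the point loop is empty, so its `f`-mass vanishes. [folklore] -/
@[simp] theorem nestingPhase_pointLoop (f : ℂ → ℝ) (x : ℂ) : (pointLoop x).nestingPhase f = 0 := by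
  rw [UnbasedLoop.nestingPhase]
  have : {z : ℂ | (pointLoop x).wind z ≠ 0} = ∅ := by
    ext z; simp
  rw [this, Measure.restrict_empty, integral_zero_measure]

/-- **Degenerate loops are invisible to the transform**: the point loop has factor `cos_μ(0) = 1` for
every test function. [folklore] -/
@[simp] theorem nestingFactor_pointLoop (f : ℂ → ℝ) (x : ℂ) : (pointLoop x).nestingFactor f = 1 :=
  UnbasedLoop.nestingFactor_eq_one_of_nestingPhase_eq_zero (nestingPhase_pointLoop f x)

/-- The circle of radius `r` about `c` traversed `n` times: `t ↦ c + r e^{2πint}`. [folklore] -/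
def windCurve (c : ℂ) (r : ℝ) (n : ℕ) : Curve ℂ :=
  ⟨⟨fun t : unitInterval ↦ c + r * Complex.exp (2 * π * Complex.I * n * (t : ℝ)), by fun_prop⟩⟩

/-- Pointwise formula. [folklore] -/
theorem windCurve_apply (c : ℂ) (r : ℝ) (n : ℕ) (t : unitInterval) :
    windCurve c r n t = c + r * Complex.exp (2 * π * Complex.I * n * (t : ℝ)) := rfl

/-- The `n`-fold circle is closed (`e^{2πin} = 1`). [folklore] -/
theorem isLoop_windCurve (c : ℂ) (r : ℝ) (n : ℕ) : (windCurve c r n).IsLoop := by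
  rw [Curve.isLoop_iff, Curve.source_def, Curve.target_def, windCurve_apply, windCurve_apply]
  simp only [Set.Icc.coe_zero, Set.Icc.coe_one, Complex.ofReal_zero, mul_zero, Complex.exp_zero,
    Complex.ofReal_one, mul_one]
  rw [show (2 * π * Complex.I * n : ℂ) = n * (2 * π * Complex.I) by ring, Complex.exp_nat_mul_two_pi_mul_I,
    mul_one]

/-- Every point of the `n`-fold circle is at distance `|r|` from the centre. [folklore] -/
theorem norm_windCurve_sub_center (c : ℂ) (r : ℝ) (n : ℕ) (t : unitInterval) :
    ‖windCurve c r n t - c‖ = |r| := by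
  rw [windCurve_apply, add_sub_cancel_left, norm_mul, Complex.norm_real, Real.norm_eq_abs,
    show (2 * π * Complex.I * n * (t : ℝ) : ℂ) = ((2 * π * n * (t : ℝ) : ℝ) : ℂ) * Complex.I by push_cast; ring,
    Complex.norm_exp_ofReal_mul_I, mul_one]

/-- The `n`-fold circle as an unbased loop. [folklore] -/
def windLoop (c : ℂ) (r : ℝ) (n : ℕ) : UnbasedLoop ℂ :=
  UnbasedLoop.mk (BasedLoop.mk (CurveClass.mk (windCurve c r n)) (CurveClass.isLoop_mk.2 (isLoop_windCurve c r n)))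

/-- The trace of the `n`-fold circle lies on the sphere of radius `|r|`. [folklore] -/
theorem range_windLoop_subset_sphere (c : ℂ) (r : ℝ) (n : ℕ) :
    (windLoop c r n).range ⊆ Metric.sphere c |r| := by
  rintro _ ⟨t, rfl⟩
  rw [Metric.mem_sphere, Complex.dist_eq]
  exact norm_windCurve_sub_center c r n t

/-- The centre is off the trace (for `r ≠ 0`). [folklore] -/
theorem center_not_mem_range_windCurve (c : ℂ) {r : ℝ} (hr : r ≠ 0) (n : ℕ) :
    c ∉ (windCurve c r n).range := by
  rintro ⟨t, ht⟩
  have := norm_windCurve_sub_center c r n t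
  rw [ht, sub_self, norm_zero] at this
  exact hr (abs_eq_zero.1 this.symm)

/-- **The `n`-fold circle winds `n` times around its centre** (explicit logarithm `log r + 2πint`).
[folklore] -/
theorem wind_windLoop_center (c : ℂ) {r : ℝ} (hr : 0 < r) (n : ℕ) : (windLoop c r n).wind c = n := by
  show (windCurve c r n).wind c = ((n : ℤ) : ℤ)
  refine Curve.wind_eq_of_log (isLoop_windCurve c r n)
    (l := fun t ↦ (Real.log r : ℂ) + 2 * π * Complex.I * n * t) (by fun_prop) (fun t ht ↦ ?_) ?_
  · rw [Complex.exp_add, ← Complex.ofReal_exp, Real.exp_log hr]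
    show (r : ℂ) * Complex.exp (2 * π * Complex.I * n * t) = windCurve c r n ⟨t, ht⟩ - c
    rw [windCurve_apply, add_sub_cancel_left]
  · push_cast; ring

/-- **… and `n` times around every point of the open disc** (Rouché: moving the point by less than
`r` does not change the winding number). [folklore] -/
theorem wind_windLoop_of_dist_lt (c : ℂ) {r : ℝ} (hr : 0 < r) (n : ℕ) {z : ℂ} (hz : dist z c < r) :
    (windLoop c r n).wind z = n := by
  rw [← wind_windLoop_center c hr n]
  show (windCurve c r n).wind z = (windCurve c r n).wind c
  unfold Curve.wind
  refine Literature.Topology.PlaneTopology.wind_eq_of_norm_sub_lt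
    (Curve.continuous_subPt _ z).continuousOn (Curve.subPt_zero_eq_one (isLoop_windCurve c r n) z)
    (Curve.isNonvanishingLoop_subPt (isLoop_windCurve c r n) (center_not_mem_range_windCurve c hr.ne' n))
    (fun t ht ↦ ?_)
  rw [Curve.subPt_of_mem _ _ ht, Curve.subPt_of_mem _ _ ht, sub_sub_sub_cancel_left,
    norm_windCurve_sub_center, abs_of_pos hr, ← dist_eq_norm, dist_comm]
  exact hz

/-- **… and zero times around every point outside the closed disc.** [folklore] -/
theorem wind_windLoop_of_lt_dist (c : ℂ) (r : ℝ) (n : ℕ) {z : ℂ} (hz : |r| < dist z c) :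
    (windLoop c r n).wind z = 0 := by
  show (windCurve c r n).wind z = 0
  refine Curve.wind_eq_zero_of_subset_ball (w := c) (ρ := dist z c) ?_ le_rfl
  rintro _ ⟨t, rfl⟩
  rw [Metric.mem_ball, dist_eq_norm, norm_windCurve_sub_center]
  exact hz

/-- The interior `{W ≠ 0}` of the `n`-fold circle (`n ≠ 0`) is the open disc up to the null circle.
[folklore] -/
theorem setOf_wind_windLoop_ae_eq_ball (c : ℂ) {r : ℝ} (hr : 0 < r) {n : ℕ} (hn : n ≠ 0) :
    {z | (windLoop c r n).wind z ≠ 0} =ᵐ[volume] Metric.ball c r := by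
  refine ae_eq_set.2 ⟨?_, ?_⟩
  · refine measure_mono_null (fun z hz ↦ ?_) (Measure.addHaar_sphere volume c r)
    rcases hz with ⟨hS, hb⟩
    rw [Metric.mem_ball, not_lt] at hb
    rcases hb.lt_or_eq with hlt | heq
    · exact absurd (wind_windLoop_of_lt_dist c r n (by rwa [abs_of_pos hr])) hS
    · exact Metric.mem_sphere.2 heq.symm
  · rw [Set.sdiff_eq_empty.2 fun z hz ↦ ?_, measure_empty]
    rw [mem_setOf_eq, wind_windLoop_of_dist_lt c hr n (Metric.mem_ball.1 hz)]
    exact_mod_cast hn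

/-- All `n`-fold circles (`n ≠ 0`) have the same `f`-mass of the interior. [folklore] -/
theorem nestingPhase_windLoop_eq (f : ℂ → ℝ) (c : ℂ) {r : ℝ} (hr : 0 < r) {n m : ℕ} (hn : n ≠ 0) (hm : m ≠ 0) :
    (windLoop c r n).nestingPhase f = (windLoop c r m).nestingPhase f := by
  unfold UnbasedLoop.nestingPhase
  exact setIntegral_congr_set ((setOf_wind_windLoop_ae_eq_ball c hr hn).trans
    (setOf_wind_windLoop_ae_eq_ball c hr hm).symm)

/-- Hence the same loop factor. [folklore] -/
theorem nestingFactor_windLoop_eq (f : ℂ → ℝ) (c : ℂ) {r : ℝ} (hr : 0 < r) {n m : ℕ} (hn : n ≠ 0) (hm : m ≠ 0) :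
    (windLoop c r n).nestingFactor f = (windLoop c r m).nestingFactor f := by
  rw [UnbasedLoop.nestingFactor, UnbasedLoop.nestingFactor, nestingPhase_windLoop_eq f c hr hn hm]

/-- The double circle and the single circle have the same trace (`e^{4πit} = e^{2πi(2t)}`,
`e^{2πit} = e^{4πi(t/2)}`, with `2t` reduced mod `1`). [folklore] -/
theorem range_windLoop_two_eq_one (c : ℂ) (r : ℝ) : (windLoop c r 2).range = (windLoop c r 1).range := by
  apply Subset.antisymm
  · rintro _ ⟨t, rfl⟩
    -- the point at parameter `t` of the double circle is the point at `fract (2t)` of the single one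
    refine ⟨⟨Int.fract (2 * (t : ℝ)), Int.fract_nonneg _, (Int.fract_lt_one _).le⟩, ?_⟩
    show windCurve c r 1 _ = windCurve c r 2 t
    rw [windCurve_apply, windCurve_apply]
    congr 2
    simp only [Nat.cast_one, mul_one, Nat.cast_ofNat]
    rw [Int.fract, Complex.ofReal_sub, mul_sub, Complex.exp_sub, Complex.ofReal_intCast,
      show (2 * π * Complex.I * (⌊2 * (t : ℝ)⌋ : ℂ)) = (⌊2 * (t : ℝ)⌋ : ℂ) * (2 * π * Complex.I) by ring,
      Complex.exp_int_mul_two_pi_mul_I, div_one]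
    push_cast; ring_nf
  · rintro _ ⟨t, rfl⟩
    refine ⟨⟨(t : ℝ) / 2, by constructor <;> linarith [t.2.1, t.2.2]⟩, ?_⟩
    show windCurve c r 2 _ = windCurve c r 1 t
    rw [windCurve_apply, windCurve_apply]
    congr 2
    push_cast; ring

/-- **Winding numbers separate the single and the double circle in DKKMO's distance**:
`d(u₁, u₂) ≥ r` (if `d < r = dist(c, trace)` then `W(u₂, c) = ±W(u₁, c)`, i.e. `2 = ±1`). [folklore] -/
theorem le_udist_windLoop_one_two (c : ℂ) {r : ℝ} (hr : 0 < r) :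
    r ≤ (windLoop c r 1).udist (windLoop c r 2) := by
  by_contra h
  rw [not_le] at h
  have hinf : r ≤ Metric.infDist c (windLoop c r 1).range := by
    rw [Metric.le_infDist (UnbasedLoop.range_nonempty _)]
    intro y hy
    have := range_windLoop_subset_sphere c r 1 hy
    rw [Metric.mem_sphere, abs_of_pos hr] at this
    rw [dist_comm, this]
  have key := UnbasedLoop.wind_eq_or_eq_neg_of_udist_lt (h.trans_le hinf)
  rw [wind_windLoop_center c hr 2, wind_windLoop_center c hr 1] at key
  norm_num at key

/-- The empty configuration. [folklore] -/
def emptyConfig : LoopConfig ℂ := ⟨fun _ ↦ ∅⟩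

/-- One loop `u`, filed under type `i`. [folklore] -/
def single (i : Fin 2) (u : UnbasedLoop ℂ) : LoopConfig ℂ := ⟨fun j ↦ if j = i then {u} else ∅⟩

/-- **Type swap** `F 0 ↔ F 1`. [folklore] -/
def swap (c : LoopConfig ℂ) : LoopConfig ℂ := ⟨![c.F 1, c.F 0]⟩

/-- The empty configuration has no loops. [folklore] -/
@[simp] theorem loops_emptyConfig : emptyConfig.loops = ∅ := by
  simp [emptyConfig, LoopConfig.loops]

/-- The loops of `single i u` are `{u}`. [folklore] -/
@[simp] theorem loops_single (i : Fin 2) (u : UnbasedLoop ℂ) : (single i u).loops = {u} := by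
  ext v
  fin_cases i <;> simp [single, LoopConfig.mem_loops_iff]

/-- `u` is filed under type `i` in `single i u`. [folklore] -/
theorem mem_single_self (i : Fin 2) (u : UnbasedLoop ℂ) : u ∈ (single i u).F i := by
  simp [single]

/-- Type swap does not change the set of all loops. [folklore] -/
@[simp] theorem loops_swap (c : LoopConfig ℂ) : (swap c).loops = c.loops := by
  ext v
  simp [swap, LoopConfig.mem_loops_iff, or_comm]

/-- Type swap does not change the big loops. [folklore] -/
@[simp] theorem bigLoops_swap (ε : ℝ) (c : LoopConfig ℂ) : (swap c).bigLoops ε = c.bigLoops ε := by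
  simp [LoopConfig.bigLoops]

/-- **The loop functional is type-blind.** [folklore] -/
@[simp] theorem nestingWeight_swap (f : ℂ → ℝ) (c : LoopConfig ℂ) :
    (swap c).nestingWeight f = c.nestingWeight f := by
  rw [LoopConfig.nestingWeight, LoopConfig.nestingWeight, loops_swap]

/-- **Every truncation of the loop functional is type-blind.** [folklore] -/
@[simp] theorem truncNestingWeight_swap (f : ℂ → ℝ) (ε : ℝ) (c : LoopConfig ℂ) :
    (swap c).truncNestingWeight f ε = c.truncNestingWeight f ε := by
  rw [LoopConfig.truncNestingWeight, LoopConfig.truncNestingWeight, bigLoops_swap]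

/-- Swapping the types of `single 0 u` gives `single 1 u`. [folklore] -/
theorem swap_single_zero (u : UnbasedLoop ℂ) : swap (single 0 u) = single 1 u := by
  ext i v
  fin_cases i <;> simp [swap, single]

/-- The truncated loop functional of `single i u` does not depend on the type `i`. [folklore] -/
theorem truncNestingWeight_single_eq (f : ℂ → ℝ) (ε : ℝ) (i j : Fin 2) (u : UnbasedLoop ℂ) :
    (single i u).truncNestingWeight f ε = (single j u).truncNestingWeight f ε := by
  simp only [LoopConfig.truncNestingWeight, LoopConfig.bigLoops, loops_single]

/-- The configuration consisting of one point loop has ALL truncated loop functionals equal to `1`,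
like the empty configuration. [folklore] -/
theorem truncNestingWeight_single_pointLoop (f : ℂ → ℝ) (ε : ℝ) (i : Fin 2) (x : ℂ) :
    (single i (pointLoop x)).truncNestingWeight f ε = 1 := by
  rw [LoopConfig.truncNestingWeight]
  refine finprod_mem_of_eqOn_one fun u hu ↦ ?_
  have hu' : u ∈ (single i (pointLoop x)).loops := LoopConfig.bigLoops_subset_loops _ _ hu
  rw [loops_single, mem_singleton_iff] at hu'
  subst hu'
  exact nestingFactor_pointLoop f x

/-- The empty configuration has all truncated loop functionals equal to `1`. [folklore] -/
theorem truncNestingWeight_emptyConfig (f : ℂ → ℝ) (ε : ℝ) : emptyConfig.truncNestingWeight f ε = 1 :=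
  LoopConfig.truncNestingWeight_empty f ε

/-- Type swap is `d_CN`-visible: a loop inside the window filed under type `0` on one side and type `1`
on the other has no partner of its own type. [folklore] -/
theorem not_isClose_single_swap {ε : ℝ} (u : UnbasedLoop ℂ)
    (hu : u.range ⊆ Metric.ball (0 : ℂ) (1 / ε)) : ¬ LoopConfig.IsClose ε (single 0 u) (single 1 u) := by
  intro h
  obtain ⟨u', hu', -⟩ := (h 0).1 u (mem_single_self 0 u) hu
  simp [single] at hu'

/-- A degenerate loop is `d_CN`-visible: a point loop inside the window has no partner in the empty
configuration. [folklore] -/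
theorem not_isClose_single_pointLoop_empty {ε : ℝ} (hε : 0 < ε) (i : Fin 2) :
    ¬ LoopConfig.IsClose ε (single i (pointLoop 0)) emptyConfig := by
  intro h
  obtain ⟨u', hu', -⟩ := (h i).1 (pointLoop 0) (mem_single_self i _)
    (by rw [range_pointLoop, singleton_subset_iff]; exact Metric.mem_ball_self (by positivity))
  exact hu'

/-- Forget the types: all loops in both families (so that `IsClose` compares loops regardless of
type). [folklore] -/
def untype (c : LoopConfig ℂ) : LoopConfig ℂ := ⟨fun _ ↦ c.loops⟩

/-- Both families of `untype c` are all loops of `c`. [folklore] -/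
@[simp] theorem untype_F (c : LoopConfig ℂ) (i : Fin 2) : (untype c).F i = c.loops := rfl

section Law

variable {Ω Ω' : Type*} [MeasurableSpace Ω] [MeasurableSpace Ω']

/-- The truncated transform of a deterministic configuration under a probability law is its truncated
loop functional. [folklore] -/
theorem truncNestingTransform_const (P : Measure Ω) [IsProbabilityMeasure P] (c : LoopConfig ℂ)
    (f : ℂ → ℝ) : truncNestingTransform P (fun _ ↦ c) f = fun ε ↦ c.truncNestingWeight f ε := by
  funext ε
  simp [truncNestingTransform]

/-- **Deterministic `d_CN`-far configurations are at coupling distance `≥ 1`** (every coupling charges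
the sure event). [folklore] -/
theorem one_le_cnLawEDist_const (P : Measure Ω) (P' : Measure Ω') [IsProbabilityMeasure P]
    {c c' : LoopConfig ℂ} (h : ∀ ε : ℝ, 0 < ε → ε ≤ 1 → ¬ LoopConfig.IsClose ε c c') :
    1 ≤ LoopConfig.cnLawEDist P (fun _ ↦ c) P' (fun _ ↦ c') := by
  simp only [LoopConfig.cnLawEDist, le_iInf_iff]
  intro ε hε Q h1 _h2 hQ
  by_cases hε1 : ε ≤ 1
  · exfalso
    have huniv : {p : Ω × Ω' | ¬ LoopConfig.IsClose ε c c'} = univ :=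
      eq_univ_of_forall fun _ ↦ h ε hε hε1
    rw [huniv] at hQ
    have hQ1 : Q univ = 1 := by
      have := congrArg (fun ν : Measure Ω ↦ ν univ) h1
      simpa [Measure.map_apply measurable_fst MeasurableSet.univ] using this
    rw [hQ1] at hQ
    exact absurd (hQ.trans_le (ENNReal.ofReal_le_one.2 hε1)) (lt_irrefl 1)
  · calc (1 : ℝ≥0∞) = ENNReal.ofReal 1 := ENNReal.ofReal_one.symm
      _ ≤ ENNReal.ofReal ε := ENNReal.ofReal_le_ofReal (not_le.1 hε1).le

end Law

/-- Union (superposition) of two typed configurations, type by type. [folklore] -/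
def union (c c' : LoopConfig ℂ) : LoopConfig ℂ := ⟨fun i ↦ c.F i ∪ c'.F i⟩

/-- The loops of a union. [folklore] -/
@[simp] theorem loops_union' (c c' : LoopConfig ℂ) : (union c c').loops = c.loops ∪ c'.loops := by
  ext u
  simp only [union, LoopConfig.mem_loops_iff, mem_union]
  tauto

/-- The big loops of a union. [folklore] -/
@[simp] theorem bigLoops_union (ε : ℝ) (c c' : LoopConfig ℂ) :
    (union c c').bigLoops ε = c.bigLoops ε ∪ c'.bigLoops ε := by
  ext u
  simp only [LoopConfig.mem_bigLoops_iff, loops_union', mem_union]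
  tauto

/-- **The truncated loop functional is multiplicative over disjoint unions** (honest case: finitely many
non-unit factors on each side; with infinitely many the `finprod` junk value `1` breaks it). [folklore] -/
theorem truncNestingWeight_union (f : ℂ → ℝ) (ε : ℝ) {c c' : LoopConfig ℂ} (hdisj : Disjoint c.loops c'.loops)
    (hc : (c.bigLoops ε ∩ Function.mulSupport (UnbasedLoop.nestingFactor f)).Finite)
    (hc' : (c'.bigLoops ε ∩ Function.mulSupport (UnbasedLoop.nestingFactor f)).Finite) :
    (union c c').truncNestingWeight f ε = c.truncNestingWeight f ε * c'.truncNestingWeight f ε := by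
  rw [LoopConfig.truncNestingWeight, LoopConfig.truncNestingWeight, LoopConfig.truncNestingWeight,
    bigLoops_union]
  exact finprod_mem_union' (hdisj.mono (LoopConfig.bigLoops_subset_loops ε c) (LoopConfig.bigLoops_subset_loops ε c'))
    hc hc'

section Superposition

variable {Ω Ω' : Type*} [MeasurableSpace Ω] [MeasurableSpace Ω']

/-- **Independent superposition multiplies truncated transforms**: under the product law, if the loop
functional of the union factorises pointwise (`truncNestingWeight_union`), then
`Λ^ε_{P ⊗ P'}(f) = Λ^ε_P(f) · Λ^ε_{P'}(f)` (Fubini for a product integrand, `integral_prod_mul`; no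
integrability needed — both sides are junk `0` together). [folklore] -/
theorem truncNestingTransform_prod (P : Measure Ω) (P' : Measure Ω') [SFinite P] [SFinite P']
    (X : Ω → LoopConfig ℂ) (X' : Ω' → LoopConfig ℂ) (f : ℂ → ℝ) {ε : ℝ}
    (h : ∀ ω ω', (union (X ω) (X' ω')).truncNestingWeight f ε =
      (X ω).truncNestingWeight f ε * (X' ω').truncNestingWeight f ε) :
    truncNestingTransform (P.prod P') (fun p ↦ union (X p.1) (X' p.2)) f ε =
      truncNestingTransform P X f ε * truncNestingTransform P' X' f ε := by
  simp only [truncNestingTransform, h]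
  exact integral_prod_mul (fun ω ↦ (X ω).truncNestingWeight f ε) (fun ω' ↦ (X' ω').truncNestingWeight f ε)

/-- **Nesting transforms multiply under independent union.** If `Λ^ε_P(f) → Λ` and `Λ^ε_{P'}(f) → Λ'`
then the independent union has transform `Λ · Λ'` (factorisation hypothesis as in
`truncNestingTransform_prod`, for all small `ε > 0`). This is the engine of the §5 conditional
counterexample: two independent ensembles with the HALF-variance Gaussian transform superpose to an
ensemble with the DKLM/CLE₆ Gaussian transform (`superposition_half_variance`). [folklore] -/
theorem hasNestingTransform_union (P : Measure Ω) (P' : Measure Ω') [SFinite P] [SFinite P']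
    (X : Ω → LoopConfig ℂ) (X' : Ω' → LoopConfig ℂ) (f : ℂ → ℝ) {Λ Λ' : ℝ}
    (h : ∀ ε : ℝ, 0 < ε → ∀ ω ω', (union (X ω) (X' ω')).truncNestingWeight f ε =
      (X ω).truncNestingWeight f ε * (X' ω').truncNestingWeight f ε)
    (hΛ : HasNestingTransform P X f Λ) (hΛ' : HasNestingTransform P' X' f Λ') :
    HasNestingTransform (P.prod P') (fun p ↦ union (X p.1) (X' p.2)) f (Λ * Λ') := by
  unfold HasNestingTransform at *
  refine (hΛ.mul hΛ').congr' ?_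
  filter_upwards [self_mem_nhdsWithin] with ε hε
  exact (truncNestingTransform_prod P P' X X' f (h ε hε)).symm

/-- **Two half-variance Gaussians make the DKLM Gaussian**: with `Q = ∬ log‖x−y‖ f(x) f(y)`,
`exp((3/8π²) Q) · exp((3/8π²) Q) = exp((3/4π²) Q)` — `σ² = 3/2π` twice gives `σ² = 3/π`. So if two
independent random loop configurations (e.g. two full-plane CLE₃'s, conditionally on their magic
bosonisation with `σ² = 3/2π`, cf. `two_point_three_doubled`) each have transform `exp((3/8π²) Q(f))`,
their superposition has EXACTLY the transform required of the CLE₆ / bond-ℤ² limit by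
`MagicFormulaZ2`/`MagicFormulaT`. [folklore] -/
theorem superposition_half_variance (P : Measure Ω) (P' : Measure Ω') [SFinite P] [SFinite P']
    (X : Ω → LoopConfig ℂ) (X' : Ω' → LoopConfig ℂ) (f : ℂ → ℝ)
    (h : ∀ ε : ℝ, 0 < ε → ∀ ω ω', (union (X ω) (X' ω')).truncNestingWeight f ε =
      (X ω).truncNestingWeight f ε * (X' ω').truncNestingWeight f ε)
    (hΛ : HasNestingTransform P X f (Real.exp (3 / (8 * π ^ 2) * ∫ x, ∫ y, Real.log ‖x - y‖ * f x * f y)))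
    (hΛ' : HasNestingTransform P' X' f (Real.exp (3 / (8 * π ^ 2) * ∫ x, ∫ y, Real.log ‖x - y‖ * f x * f y))) :
    HasNestingTransform (P.prod P') (fun p ↦ union (X p.1) (X' p.2)) f
      (Real.exp (3 / (4 * π ^ 2) * ∫ x, ∫ y, Real.log ‖x - y‖ * f x * f y)) := by
  have key := hasNestingTransform_union P P' X X' f h hΛ hΛ'
  rw [← Real.exp_add] at key
  convert key using 2
  ring

end Superposition

/-- **SSW's moment generating function** of the log-conformal-radius decrement `B_κ` between successive
nested CLE_κ loops around a point (Schramm–Sheffield–Wilson, CMP 288 (2009), arXiv:math/0611687,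
Theorem 1 and display (mgf), p. 3 of the held text: `E[exp(λ B_κ)] = −cos(4π/κ)/cos(π√((1−4/κ)² +
8λ/κ))` for `Re λ < 1 − 2/κ − 3κ/32`, `8/3 < κ < 8`). Transcribed as a real function of `(κ, λ)`.
[cite: SchrammSheffieldWilson2009, Thm 1] -/
def sswMGF (κ l : ℝ) : ℝ :=
  -Real.cos (4 * π / κ) / Real.cos (π * Real.sqrt ((1 - 4 / κ) ^ 2 + 8 * l / κ))

/-- **Dense–dilute duality of CLE nesting (κ = 6 vs κ' = 3, `1/κ + 1/κ' = 1/2`)**: `E[e^{λ B₃}] =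
E[e^{2λ B₆}]` identically, i.e. `B₃ = 2 B₆` in law: the nested CLE₃ loops around a point are, in
log-conformal radius, exactly twice as sparse as CLE₆'s with the same shape. Hence every one-point
nesting exponent of CLE₃ (for every loop weight `w`) is half that of CLE₆, and the superposition of two
independent CLE₃'s reproduces ALL one-point twisted nesting exponents of CLE₆ — including the linear
(background-charge) terms of the `μ = 1/6` twist. [folklore] -/
theorem sswMGF_three_eq_six (l : ℝ) : sswMGF 3 l = sswMGF 6 (2 * l) := by
  unfold sswMGF
  have h1 : Real.cos (4 * π / 3) = Real.cos (4 * π / 6) := by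
    rw [show 4 * π / 3 = 2 * π - 2 * π / 3 by ring, Real.cos_two_pi_sub]
    congr 1; ring
  have h2 : (1 - 4 / 3 : ℝ) ^ 2 + 8 * l / 3 = (1 - 4 / 6) ^ 2 + 8 * (2 * l) / 6 := by ring
  rw [h1, h2]

/-- **General dense–dilute duality of SSW's law**: for `1/κ + 1/κ' = 1/2` (same loop weight
`n = −2cos(4π/κ) = −2cos(4π/κ')`, dense `κ ∈ [4,8)` vs dilute `κ' ∈ (8/3,4]`: `(6,3)`, `(16/3, 16/5)`,
`(8, 8/3)`, …) one has `E[e^{l B_{κ'}}] = E[e^{(κ'/κ)·… }]`, precisely `sswMGF κ' l = sswMGF κ (κ' l/κ)`… stated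
here in the solved form `κ' = 2κ/(κ−2)`: `B_{κ'} = (κ/κ') B_κ = ((κ−2)/2) B_κ` in law. [folklore] -/
theorem sswMGF_dilute_eq_dense {κ : ℝ} (hκ : κ ≠ 0) (hκ2 : κ ≠ 2) (l : ℝ) :
    sswMGF (2 * κ / (κ - 2)) l = sswMGF κ ((κ - 2) / 2 * l) := by
  have hsub : κ - 2 ≠ 0 := sub_ne_zero.2 hκ2
  unfold sswMGF
  have h1 : Real.cos (4 * π / (2 * κ / (κ - 2))) = Real.cos (4 * π / κ) := by
    rw [show 4 * π / (2 * κ / (κ - 2)) = 2 * π - 4 * π / κ by field_simp; ring, Real.cos_two_pi_sub]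
  have h2 : (1 - 4 / (2 * κ / (κ - 2))) ^ 2 + 8 * l / (2 * κ / (κ - 2)) =
      (1 - 4 / κ) ^ 2 + 8 * ((κ - 2) / 2 * l) / κ := by
    field_simp
    ring
  rw [h1, h2]

/-- The `μ = 1/6`-twisted one-point nesting exponent of CLE_κ read off SSW's MGF for the dense/dilute
pair `κ ∈ {6, 3}` (`cos(4π/κ) = −1/2`, `(1−4/κ)² = 1/9`): with loop weight `w = 2cos θ` the exponent
`α` in `E[w^{N_ε}] ≈ ε^{α}` solves `cos(π√(1/9 − 8α/κ)) = cos θ`, i.e. `α_κ(θ) = (κ/8)(1/9 − θ²/π²)`;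
for the magic weight `θ = λ + π/3` (loop factor `2cos(λ + π/3)`): `Δ_κ(λ) := −α_κ(λ + π/3) =
(κ/8)((λ/π + 1/3)² − 1/9)`. [cite: SchrammSheffieldWilson2009, Thm 1] -/
def magicExponent (κ lam : ℝ) : ℝ := κ / 8 * ((lam / π + 1 / 3) ^ 2 - 1 / 9)

/-- `Δ₆(λ) = 3λ²/4π² + λ/2π` (the value quoted in the route, NUMBERS). [folklore] -/
theorem magicExponent_six (lam : ℝ) : magicExponent 6 lam = 3 * lam ^ 2 / (4 * π ^ 2) + lam / (2 * π) := by
  unfold magicExponent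
  field_simp
  ring

/-- `Δ₃(λ) = Δ₆(λ)/2`. [folklore] -/
theorem magicExponent_three (lam : ℝ) : magicExponent 3 lam = magicExponent 6 lam / 2 := by
  unfold magicExponent; ring

/-- **Two-point check of the magic formula for CLE₆**: `Δ₆(λ) + Δ₆(−λ) = σ² λ²/(2π)` with `σ² = 3/π`
(the Gaussian functional `exp(−(σ²/2)∬ G f f)`, `G = −(1/2π) log`, gives the ε-exponent `σ²λ²/2π` for
`f = λ(δ_x − δ_y)`; linear terms cancel by charge neutrality). [folklore] -/
theorem two_point_six (lam : ℝ) :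
    magicExponent 6 lam + magicExponent 6 (-lam) = (3 / π) * lam ^ 2 / (2 * π) := by
  unfold magicExponent
  field_simp
  ring

/-- **Two-point exponent of CLE₃ at the same twist**: `σ² = 3/2π = half`; so TWO independent CLE₃'s
give exactly the CLE₆ value `σ² = 3/π` (and `2Δ₃(±λ) = Δ₆(±λ)` term by term). Coulomb gas: `σ²(κ) =
2/(gπ) = κ/2π` with `g = 4/κ`, `n = −2cos(πg) = 1` for both `g = 2/3` (dense, κ = 6) and `g = 4/3`
(dilute, κ = 3, critical Ising domain walls / dilute O(1) on the honeycomb lattice). [folklore] -/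
theorem two_point_three_doubled (lam : ℝ) :
    2 * (magicExponent 3 lam + magicExponent 3 (-lam)) = (3 / π) * lam ^ 2 / (2 * π) := by
  rw [magicExponent_three, magicExponent_three, ← two_point_six]; ring



/-! ### The named fact, proved -/

/-- Witness (1): the circle of radius `1/2` about `0` filed under type `0` versus type `1`. [folklore] -/
theorem typed_witness :
    ∃ c c' : LoopConfig ℂ, c.loops.Finite ∧ c'.loops.Finite ∧ (∀ u ∈ c.loops ∪ c'.loops, ∃ z, u.wind z ≠ 0) ∧
      (∀ (f : ℂ → ℝ) (ε : ℝ), c.truncNestingWeight f ε = c'.truncNestingWeight f ε) ∧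
      ¬ LoopConfig.IsClose 1 c c' := by
  have hr : (0 : ℝ) < 1 / 2 := by norm_num
  refine ⟨single 0 (windLoop 0 (1 / 2) 1), single 1 (windLoop 0 (1 / 2) 1), ?_, ?_, ?_, ?_, ?_⟩
  · rw [loops_single]; exact finite_singleton _
  · rw [loops_single]; exact finite_singleton _
  · intro u hu
    rw [loops_single, loops_single, union_self, mem_singleton_iff] at hu
    subst hu
    exact ⟨0, by rw [wind_windLoop_center 0 hr 1]; norm_num⟩
  · intro f ε; exact truncNestingWeight_single_eq f ε 0 1 _
  · refine not_isClose_single_swap _ fun z hz ↦ ?_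
    have := range_windLoop_subset_sphere 0 (1 / 2) 1 hz
    rw [Metric.mem_sphere, abs_of_pos hr] at this
    rw [Metric.mem_ball, this]; norm_num

/-- Witness (2): the circle of radius `1/2` about `0` traversed once versus twice, compared untyped.
[folklore] -/
theorem untyped_witness :
    ∃ c c' : LoopConfig ℂ, c.loops.Finite ∧ c'.loops.Finite ∧ (∀ u ∈ c.loops ∪ c'.loops, ∃ z, u.wind z ≠ 0) ∧
      (∀ (f : ℂ → ℝ) (ε : ℝ), c.truncNestingWeight f ε = c'.truncNestingWeight f ε) ∧
      ¬ LoopConfig.IsClose (1 / 4) (⟨fun _ ↦ c.loops⟩ : LoopConfig ℂ) ⟨fun _ ↦ c'.loops⟩ := by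
  have hr : (0 : ℝ) < 1 / 2 := by norm_num
  set u₁ : UnbasedLoop ℂ := windLoop 0 (1 / 2) 1 with hu₁
  set u₂ : UnbasedLoop ℂ := windLoop 0 (1 / 2) 2 with hu₂
  have hfac : ∀ f : ℂ → ℝ, u₁.nestingFactor f = u₂.nestingFactor f := fun f ↦
    nestingFactor_windLoop_eq f 0 hr one_ne_zero two_ne_zero
  have hrange : u₂.range = u₁.range := range_windLoop_two_eq_one 0 (1 / 2)
  refine ⟨single 0 u₁, single 0 u₂, ?_, ?_, ?_, ?_, ?_⟩
  · rw [loops_single]; exact finite_singleton _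
  · rw [loops_single]; exact finite_singleton _
  · intro u hu
    rw [loops_single, loops_single, mem_union, mem_singleton_iff, mem_singleton_iff] at hu
    rcases hu with rfl | rfl
    · exact ⟨0, by rw [hu₁, wind_windLoop_center 0 hr 1]; norm_num⟩
    · exact ⟨0, by rw [hu₂, wind_windLoop_center 0 hr 2]; norm_num⟩
  · intro f ε
    simp only [LoopConfig.truncNestingWeight, LoopConfig.bigLoops, loops_single]
    by_cases hε : ε ≤ Metric.diam u₁.range
    · have h1 : {u ∈ ({u₁} : Set (UnbasedLoop ℂ)) | ε ≤ Metric.diam u.range} = {u₁} := by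
        ext u; simp only [mem_setOf_eq, mem_singleton_iff]; constructor
        · exact fun h ↦ h.1
        · intro h; exact ⟨h, h ▸ hε⟩
      have h2 : {u ∈ ({u₂} : Set (UnbasedLoop ℂ)) | ε ≤ Metric.diam u.range} = {u₂} := by
        ext u; simp only [mem_setOf_eq, mem_singleton_iff]; constructor
        · exact fun h ↦ h.1
        · intro h; exact ⟨h, h ▸ hrange ▸ hε⟩
      rw [h1, h2, finprod_mem_singleton, finprod_mem_singleton, hfac]
    · have h1 : {u ∈ ({u₁} : Set (UnbasedLoop ℂ)) | ε ≤ Metric.diam u.range} = ∅ := by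
        ext u; simp only [mem_setOf_eq, mem_singleton_iff, mem_empty_iff_false, iff_false, not_and]
        intro h; exact h ▸ hε
      have h2 : {u ∈ ({u₂} : Set (UnbasedLoop ℂ)) | ε ≤ Metric.diam u.range} = ∅ := by
        ext u; simp only [mem_setOf_eq, mem_singleton_iff, mem_empty_iff_false, iff_false, not_and]
        intro h; exact h ▸ hrange ▸ hε
      rw [h1, h2, finprod_mem_empty]
  · intro hclose
    obtain ⟨v, hv, hd⟩ := (hclose 0).1 u₁ (by simp) (by
      intro z hz
      have := range_windLoop_subset_sphere 0 (1 / 2) 1 hz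
      rw [Metric.mem_sphere, abs_of_pos hr] at this
      rw [Metric.mem_ball, this]; norm_num)
    simp only [loops_single, mem_singleton_iff] at hv
    subst hv
    have := le_udist_windLoop_one_two 0 hr
    linarith

/-- Witness (3): Dirac laws on witness (1). [folklore] -/
theorem law_witness :
    ∃ (P P' : Measure Unit) (X X' : Unit → LoopConfig ℂ), IsProbabilityMeasure P ∧ IsProbabilityMeasure P' ∧
      (∀ (f : ℂ → ℝ) (Λ : ℝ), HasNestingTransform P X f Λ ↔ HasNestingTransform P' X' f Λ) ∧
      1 ≤ LoopConfig.cnLawEDist P X P' X' := by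
  have hr : (0 : ℝ) < 1 / 2 := by norm_num
  set u : UnbasedLoop ℂ := windLoop 0 (1 / 2) 1 with hu
  have hball : ∀ ε : ℝ, 0 < ε → ε ≤ 1 → u.range ⊆ Metric.ball (0 : ℂ) (1 / ε) := by
    intro ε hε hε1 z hz
    have hz' := range_windLoop_subset_sphere 0 (1 / 2) 1 hz
    rw [Metric.mem_sphere, abs_of_pos hr] at hz'
    rw [Metric.mem_ball, hz']
    have : (1 : ℝ) ≤ 1 / ε := by rw [le_div_iff₀ hε]; linarith
    linarith
  refine ⟨Measure.dirac (), Measure.dirac (), fun _ ↦ single 0 u, fun _ ↦ single 1 u, inferInstance,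
    inferInstance, fun f Λ ↦ ?_, ?_⟩
  · simp only [HasNestingTransform, truncNestingTransform_const]
    rw [funext fun ε ↦ truncNestingWeight_single_eq f ε 0 1 u]
  · exact one_le_cnLawEDist_const (Measure.dirac ()) (Measure.dirac ())
      (fun ε hε hε1 ↦ not_isClose_single_swap u (hball ε hε hε1))

end NestingBlind

/-- **The barrier holds.** [folklore] -/
theorem nestingTransformBlindness_holds : NestingTransformBlindness :=
  ⟨NestingBlind.typed_witness, NestingBlind.untyped_witness, NestingBlind.law_witness⟩

end Literature.Barriers.CriticalPhenomena

end
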